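import Summits.MatrixMultiplication.OmegaCensus.STPPVosperSlackPairingHoles
import Summits.MatrixMultiplication.OmegaCensus.STPPVosperSlackTwoChain
import Summits.MatrixMultiplication.OmegaCensus.STPPVosperTilingWordsEnumExtract

/-!
# ω-census (abelian STPP census): the case-independent layer of a slack-`s` "partition law" — pairing-with-holes AND cover-with-words extraction (kernel)

HONEST FRAMING (pub-omega census; verbatim): lottery ticket; floor = certified bounds/negative ranges.
Census STRUCTURE (seat pub-omega-stpp-2 gen 26, 2026-08-28; RULING L37-134 (b): the 'LawS2 skeleton' — tool + skeleton = stpp-2, the dual-chain law text,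
per-case shape lemmas, leaf rows and kills = seat stpp-1's lineage, HOME `pub-omega-stpp-1-g32/SLACK2-DESIGN.md`), family (b2).
For an STPP family at prime order `p`, a block `i`, the other blocks `ks`, write (the `C`-reading of block `i`)
`W = {c − a − b}`, `SY = (−Aᵢ) + Y°`, `T = (−Bᵢ) + Z°` (`Y° = ⋃_{k≠i}(C_k − B_k)`, `Z° = ⋃_{k≠i}(C_k − A_k)`); `W`, `SY`, `T` are pairwise disjoint
(`STPPVosperSlackTwoChain.lean`), so `R := ℤ/p ∖ (SY ∪ T) ⊇ W` and `#R = p − #SY − #T`.  Whatever inverse theorem a case uses (Vosper, Hamidoune–Rødseth,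
an explicit enumeration), its OUTPUT is shape data: a unit `u` with `u e′ = 1`, `−Aᵢ = {s₀ + ε•d : ε ∈ AD}`, `Bᵢ = {β + δ•e′ : δ ∈ BD}`, and transported value
sets `SYV`, `TV ⊆ [0,p)` of `SY`, `T` under `x ↦ (u x + w).val`, plus value lists `YL`, `ZL` of `Y°`, `Z°` relative to base points `y₀`, `z₀`.  Given only that
(the per-case hypotheses of a leaf law are these named facts), this file extracts the two kernel-decidable consequences every table/row file tests:
* `pairingK_of_isSTPP` : `coverByF k p (patN2 p (u d).val AD BD) fuel k ((range p).filter (· ∉ SYV ∪ TV)) = true` for `p ≤ #SY + #T + vol + k`,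
  `fuel ≥ |Cᵢ| + k` (`coverByFk_blockSum2`; UNCONDITIONAL) — SLACK2-DESIGN test (i);
* `pairingK_and_cover_of_isSTPP` : that, AND `existsCoverW p YL ZL (ks.map …) [] [] [] = true` in both search orders for any sound block enumerator
  (`existsCoverW_both_of_isSTPP_enum`) — test (ii).
A leaf law contraposes: its table row says one of the tests returns `false`.  Nothing here is progress on `ω`.

References: H. Cohn, R. Kleinberg, B. Szegedy, C. Umans, FOCS 2005 (arXiv:math/0511460), Def. 5.1; A. G. Vosper, J. London Math. Soc. 31 (1956).
-/

open Finset
open scoped Pointwise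

namespace Summit.MatrixMultiplication.OmegaCensus.CubeNB

open Literature.Computability.AlgebraicComplexity
open Literature.Combinatorics.Additive
open Summit.MatrixMultiplication.OmegaCensus.STPPKneser

section Core

variable {p : ℕ} [hp : Fact p.Prime] {N : ℕ} {A B C : Fin N → Finset (ZMod p)}

/-- `W ⊆ ℤ/p ∖ (SY ∪ T)`: the block sum-set misses both small sumsets. [cite: CohnKleinbergSzegedyUmans2005, Def. 5.1] -/
theorem W_subset_univ_sdiff_SY_T (hS : IsSTPP A B C) (i : Fin N) :
    (((A i) ×ˢ ((B i) ×ˢ (C i))).image fun q : ZMod p × ZMod p × ZMod p => (0 : ZMod p) + q.2.2 - q.1 - q.2.1) ⊆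
      univ \ (((A i).image (fun a => (0 : ZMod p) - a) + DU B C (univ.erase i)) ∪
        ((B i).image (fun b => (0 : ZMod p) - b) + DU A C (univ.erase i))) := by
  intro w hw
  rw [Finset.mem_sdiff, Finset.mem_union, not_or]
  refine ⟨Finset.mem_univ w, fun h => Finset.disjoint_left.1 (disjoint_W_negA_add_DU hS i) hw h, fun h => ?_⟩
  exact Finset.disjoint_left.1 (disjoint_negB_add_DU_AC hS i) h (Finset.mem_union_left _ hw)

/-- `#(ℤ/p ∖ (SY ∪ T)) = p − #SY − #T` (`SY` and `T` are disjoint). [cite: CohnKleinbergSzegedyUmans2005, Def. 5.1] -/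
theorem card_univ_sdiff_SY_T (hS : IsSTPP A B C) (i : Fin N) :
    #(univ \ (((A i).image (fun a => (0 : ZMod p) - a) + DU B C (univ.erase i)) ∪
        ((B i).image (fun b => (0 : ZMod p) - b) + DU A C (univ.erase i)))) =
      p - #((A i).image (fun a => (0 : ZMod p) - a) + DU B C (univ.erase i)) - #((B i).image (fun b => (0 : ZMod p) - b) + DU A C (univ.erase i)) := by
  have hdisj : Disjoint ((A i).image (fun a => (0 : ZMod p) - a) + DU B C (univ.erase i))
      ((B i).image (fun b => (0 : ZMod p) - b) + DU A C (univ.erase i)) :=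
    ((disjoint_negB_add_DU_AC hS i).mono_right Finset.subset_union_right).symm
  rw [Finset.card_sdiff_of_subset (Finset.subset_univ _), Finset.card_univ, ZMod.card, Finset.card_union_of_disjoint hdisj]
  omega

/-- The transported values of a complement: `((ℤ/p ∖ M)·Φ).val = {x < p : x ∉ (M·Φ).val}` for an injective `Φ`. [folklore] -/
theorem image_val_univ_sdiff {Φ : ZMod p → ZMod p} (hΦ : Function.Injective Φ) (M : Finset (ZMod p)) :
    ((univ \ M).image Φ).image ZMod.val = (range p).filter fun x => x ∉ (M.image Φ).image ZMod.val := by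
  have hΦs : Function.Surjective Φ := Finite.surjective_of_injective hΦ
  ext x
  simp only [Finset.mem_image, Finset.mem_filter, Finset.mem_range, Finset.mem_sdiff, Finset.mem_univ, true_and]
  constructor
  · rintro ⟨y, ⟨z, hzM, rfl⟩, rfl⟩
    refine ⟨ZMod.val_lt _, ?_⟩
    rintro ⟨y', ⟨z', hz'M, rfl⟩, hyy⟩
    have : z' = z := hΦ (ZMod.val_injective p hyy)
    exact hzM (this ▸ hz'M)
  · rintro ⟨hlt, hnot⟩
    obtain ⟨z, hz⟩ := hΦs (x : ZMod p)
    have hxval : (x : ZMod p).val = x := by rw [ZMod.val_natCast, Nat.mod_eq_of_lt hlt]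
    refine ⟨Φ z, ⟨z, fun hzM => hnot ⟨Φ z, ⟨z, hzM, rfl⟩, by rw [hz, hxval]⟩, rfl⟩, by rw [hz, hxval]⟩

/-- **Pairing with holes, extracted (SLACK2-DESIGN test (i)).**  For an STPP family, a block `i` with `−Aᵢ = {s₀ + ε•d : ε ∈ AD}`, `Bᵢ = {β + δ•e′ : δ ∈ BD}`
(`AD`, `BD` below `p`), a unit `u` with `u e′ = 1`, a shift `w`, and the transported value sets `SYV`, `TV` of `SY = (−Aᵢ)+Y°`, `T = (−Bᵢ)+Z°`: if
`p ≤ #SY + #T + |Aᵢ||Bᵢ||Cᵢ| + k` (at most `k` points of `ℤ/p` lie outside `W ⊔ SY ⊔ T`) and `|Cᵢ| + k ≤ fuel`, then the window complement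
`{x < p : x ∉ SYV ∪ TV}` passes `coverByFk` with the combined pattern `patN2 p (u d).val AD BD`. [cite: CohnKleinbergSzegedyUmans2005, Def. 5.1] -/
theorem pairingK_of_isSTPP (hS : IsSTPP A B C) (i : Fin N) {u e' d s₀ β w : ZMod p} (hue : u * e' = 1) {AD BD : Finset ℕ}
    (hAD : ∀ ε ∈ AD, ε < p) (hBD : ∀ δ ∈ BD, δ < p)
    (hSn : (A i).image (fun x => (0 : ZMod p) - x) = AD.image fun ε : ℕ => s₀ + ε • d) (hB : B i = BD.image fun δ : ℕ => β + δ • e')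
    {SYV TV : Finset ℕ} {k fuel : ℕ}
    (hSYV : (((A i).image (fun a => (0 : ZMod p) - a) + DU B C (univ.erase i)).image fun x => u * x + w).image ZMod.val = SYV)
    (hTV : (((B i).image (fun b => (0 : ZMod p) - b) + DU A C (univ.erase i)).image fun x => u * x + w).image ZMod.val = TV)
    (hk : p ≤ #((A i).image (fun a => (0 : ZMod p) - a) + DU B C (univ.erase i)) +
      #((B i).image (fun b => (0 : ZMod p) - b) + DU A C (univ.erase i)) + #(A i) * #(B i) * #(C i) + k)
    (hfuel : #(C i) + k ≤ fuel) :
    coverByFk p (patN2 p (u * d).val AD BD) fuel k ((range p).filter fun x => x ∉ SYV ∪ TV) = true := by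
  set SY := (A i).image (fun a => (0 : ZMod p) - a) + DU B C (univ.erase i) with hSY
  set T := (B i).image (fun b => (0 : ZMod p) - b) + DU A C (univ.erase i) with hT
  set R := univ \ (SY ∪ T) with hR
  have hu0 : u ≠ 0 := fun h => by rw [h, zero_mul] at hue; exact zero_ne_one hue
  have hφinj : Function.Injective (fun x : ZMod p => u * x + w) := affine_injective hu0 w
  have hWR := W_subset_univ_sdiff_SY_T hS i
  have hRcard := card_univ_sdiff_SY_T hS i
  rw [← hSY, ← hT, ← hR] at hWR hRcard
  have hWcard := card_image_blockSum hS i (0 : ZMod p)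
  have hRk : #R ≤ #(((A i) ×ˢ ((B i) ×ˢ (C i))).image fun q : ZMod p × ZMod p × ZMod p => (0 : ZMod p) + q.2.2 - q.1 - q.2.1) + k := by
    rw [hWcard, hRcard]; omega
  have hX : (R.image fun x => u * x + w).image ZMod.val = (range p).filter fun x => x ∉ SYV ∪ TV := by
    rw [hR, image_val_univ_sdiff hφinj, Finset.image_union, Finset.image_union, hSYV, hTV]
  rw [← hX]
  exact coverByFk_blockSum2 hS i hue hAD hBD hSn hB hWR hRk hfuel

/-- **Both kernel tests, extracted (SLACK2-DESIGN tests (i) + (ii)).**  Under the hypotheses of `pairingK_of_isSTPP` and, for the cover stage, a sound block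
enumerator `bd`, the other indices `ks` (duplicate-free, complete), duplicate-free value lists `YL`, `ZL` of `Y°`, `Z°` relative to base points `y₀`, `z₀`
(same unit `u`): the pairing test with holes AND both one-pass cover searches with the Def-5.1 words return `true`.  A leaf law contraposes against its
tables/rows. [cite: CohnKleinbergSzegedyUmans2005, Def. 5.1] -/
theorem pairingK_and_cover_of_isSTPP {bd : List ℕ → List ℕ → ℕ → ℕ → ℕ → List (List ℕ × List ℕ × List ℕ)} (hbd : BlockEnumSound p bd)
    (hS : IsSTPP A B C) (hA : ∀ k, (A k).Nonempty) (hB : ∀ k, (B k).Nonempty) (hC : ∀ k, (C k).Nonempty)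
    (i : Fin N) (ks : List (Fin N)) (hks : ks.Nodup) (hksi : ∀ k, k ∈ ks ↔ k ≠ i)
    {u e' d s₀ β w y₀ z₀ : ZMod p} (hue : u * e' = 1) {AD BD : Finset ℕ} (hAD : ∀ ε ∈ AD, ε < p) (hBD : ∀ δ ∈ BD, δ < p)
    (hSn : (A i).image (fun x => (0 : ZMod p) - x) = AD.image fun ε : ℕ => s₀ + ε • d) (hBi : B i = BD.image fun δ : ℕ => β + δ • e')
    {SYV TV : Finset ℕ} {k fuel : ℕ}
    (hSYV : (((A i).image (fun a => (0 : ZMod p) - a) + DU B C (univ.erase i)).image fun x => u * x + w).image ZMod.val = SYV)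
    (hTV : (((B i).image (fun b => (0 : ZMod p) - b) + DU A C (univ.erase i)).image fun x => u * x + w).image ZMod.val = TV)
    (hk : p ≤ #((A i).image (fun a => (0 : ZMod p) - a) + DU B C (univ.erase i)) +
      #((B i).image (fun b => (0 : ZMod p) - b) + DU A C (univ.erase i)) + #(A i) * #(B i) * #(C i) + k)
    (hfuel : #(C i) + k ≤ fuel) {YL ZL : List ℕ} (hYL : YL.Nodup) (hZL : ZL.Nodup)
    (hY1 : ∀ x ∈ DU B C (univ.erase i), (u * (x - y₀)).val ∈ YL) (hY2 : ∀ t ∈ YL, ∃ x ∈ DU B C (univ.erase i), (u * (x - y₀)).val = t)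
    (hZ1 : ∀ x ∈ DU A C (univ.erase i), (u * (x - z₀)).val ∈ ZL) (hZ2 : ∀ t ∈ ZL, ∃ x ∈ DU A C (univ.erase i), (u * (x - z₀)).val = t) :
    coverByFk p (patN2 p (u * d).val AD BD) fuel k ((range p).filter fun x => x ∉ SYV ∪ TV) = true ∧
      existsCoverW p YL ZL (ks.map fun k => bd YL ZL #(A k) #(B k) #(C k)) [] [] [] = true ∧
      existsCoverW p ZL YL (ks.map fun k => bd ZL YL #(B k) #(A k) #(C k)) [] [] [] = true := by
  have hu0 : u ≠ 0 := fun h => by rw [h, zero_mul] at hue; exact zero_ne_one hue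
  exact ⟨pairingK_of_isSTPP hS i hue hAD hBD hSn hBi hSYV hTV hk hfuel,
    existsCoverW_both_of_isSTPP_enum hbd hS hA hB hC i ks hks hksi hu0 hYL hZL hY1 hY2 hZ1 hZ2⟩

end Core

end Summit.MatrixMultiplication.OmegaCensus.CubeNB
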